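import Literature.RepresentationTheory.CompactGroups.CircleWeightSpaces
import Mathlib.Algebra.DirectSum.LinearMap
import HarnessLib

/-!
# A finite-dimensional continuous representation of the torus `U(1)^ι` is the direct sum of its weight spaces,
# and its character on the torus is `Σ_m (dim W_m) · u^m`

Topic `RepresentationTheory/CompactGroups`; namespace `Literature.RepresentationTheory.CompactGroups.TorusWeights`.
Theorems only (no definition, no named fact, no instance, no `sorry`): the sequel of the tree's `CircleWeightSpaces`
(the case `ι = pt`) for a FINITE-RANK torus `T = ι → Circle` (`ι` a `Fintype`), Bröcker–tom Dieck II (8.1)–(8.2)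
[BrockerTomDieck1985]: "every complex `T`-module is the direct sum of its weight spaces", the weights of
`T = U(1)^ι` being the characters `u ↦ ∏ᵢ uᵢ^{mᵢ}`, `m ∈ ℤ^ι` (II (8.1) for the factors and
`∏ᵢ Pi.mulSingle i (u i) = u`).  For `ρ : (ι → Circle) →* Module.End ℂ W` with continuous orbit maps on a
finite-dimensional Hausdorff topological vector space `W`, and the JOINT WEIGHT SPACE of weight `m : ι → ℤ` written
throughout as the Mathlib term `⨅ u, Module.End.eigenspace (ρ u) (∏ i, (u i : ℂ) ^ m i)`:

* `TorusWeights.dense_isOfFinOrder` — the torsion of `U(1)^ι` is dense;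
* `TorusWeights.exists_eq_prod_zpow` — a continuous character `c : U(1)^ι →* ℂ` is `u ↦ ∏ᵢ uᵢ^{mᵢ}` for a unique
  `m ∈ ℤ^ι` (`existsUnique_eq_prod_zpow`);
* `TorusWeights.iSupIndep_weightSpace` / `iSup_weightSpace_eq_top` / `isInternal_weightSpace` /
  `finite_weightSpace_ne_bot` — independence, spanning, `W = ⊕_m W_m`, finitely many weights;
* `TorusWeights.trace_eq_sum_finrank_mul_prod_zpow` — **the character on the torus**:
  `Tr ρ(u) = Σ_{m : W_m ≠ 0} (dim W_m) ∏ᵢ uᵢ^{mᵢ}` and `Σ_{m : W_m ≠ 0} dim W_m = dim W`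
  (`sum_finrank_weightSpace_eq`); `weightSpace_ne_bot_iff` (a weight occurs iff it has a non-zero weight vector).

Proof = the `CircleWeightSpaces` proof with `U(1)` replaced by `U(1)^ι` (dense torsion acting by commuting semisimple
operators, Mathlib's joint-eigenspace machinery, closed lines, and the classification of continuous characters through
the coordinate circles), plus Mathlib's `LinearMap.trace_eq_sum_trace_restrict'` for the trace.  Written for the
`hodgecm-mathlib` cell (road HC, node H4b: the `K̂`-dictionary of `U(2) × U(1)` by torus weights), generic and reusable.

## References
* T. Bröcker, T. tom Dieck, *Representations of Compact Lie Groups*, GTM 98 (1985), II (8.1), (8.2) [BrockerTomDieck1985].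
-/

set_option autoImplicit false

noncomputable section

open Module Module.End Polynomial Filter Topology

namespace Literature.RepresentationTheory.CompactGroups

namespace TorusWeights

variable {ι : Type*} [Fintype ι]

/-! ### The torus `U(1)^ι`: dense torsion and continuous characters -/

/-- **The torsion of the torus `U(1)^ι` is dense** (product of the dense torsion of the factors; Bröcker–tom Dieck I (4.13)–(4.14):
generators and torsion of tori). [cite: BrockerTomDieck1985, I (4.13)] -/
theorem dense_isOfFinOrder : Dense {u : ι → Circle | IsOfFinOrder u} := by
  have h : Set.pi Set.univ (fun _ : ι => {z : Circle | IsOfFinOrder z}) ⊆ {u : ι → Circle | IsOfFinOrder u} :=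
    fun u hu => IsOfFinOrder.pi fun i => hu i (Set.mem_univ i)
  exact Dense.mono h (dense_pi Set.univ fun i _ => CircleWeights.dense_isOfFinOrder)

/-- The characters `u ↦ ∏ᵢ uᵢ^{mᵢ}` of `U(1)^ι`, `m ∈ ℤ^ι`, are multiplicative. [cite: BrockerTomDieck1985, II (8.1)] -/
theorem prod_zpow_map_mul (m : ι → ℤ) (u v : ι → Circle) :
    (∏ i, ((u * v) i : ℂ) ^ m i) = (∏ i, (u i : ℂ) ^ m i) * ∏ i, (v i : ℂ) ^ m i := by
  rw [← Finset.prod_mul_distrib]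
  refine Finset.prod_congr rfl fun i _ => ?_
  rw [Pi.mul_apply, Circle.coe_mul, mul_zpow]

/-- The value of `u ↦ ∏ᵢ uᵢ^{mᵢ}` on a coordinate circle `Pi.mulSingle i z` is `z^{mᵢ}`. [cite: BrockerTomDieck1985, II (8.1)] -/
theorem prod_zpow_mulSingle [DecidableEq ι] (m : ι → ℤ) (i : ι) (z : Circle) :
    (∏ j, ((Pi.mulSingle i z : ι → Circle) j : ℂ) ^ m j) = (z : ℂ) ^ m i := by
  rw [Finset.prod_eq_single i]
  · rw [Pi.mulSingle_eq_same]
  · intro j _ hj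
    rw [Pi.mulSingle_eq_of_ne hj, Circle.coe_one, one_zpow]
  · intro h
    exact absurd (Finset.mem_univ i) h

/-- **The characters `u ↦ ∏ᵢ uᵢ^{mᵢ}` are pairwise distinct** as functions `U(1)^ι → ℂ` (`m ↦ χ_m` is injective).
[cite: BrockerTomDieck1985, II (8.1)] -/
theorem prod_zpow_injective :
    Function.Injective fun m : ι → ℤ => fun u : ι → Circle => ∏ i, (u i : ℂ) ^ m i := by
  classical
  intro m m' h
  funext i
  refine CircleChar.zpow_injective' fun z => ?_
  have hz := congr_fun h (Pi.mulSingle i z)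
  simp only [prod_zpow_mulSingle] at hz
  ext
  rw [Circle.coe_zpow, Circle.coe_zpow, hz]

/-- **Continuous characters of the torus**: a continuous homomorphism `c : U(1)^ι →* ℂ` is `u ↦ ∏ᵢ uᵢ^{mᵢ}` for some
`m ∈ ℤ^ι` (Bröcker–tom Dieck II (8.1) on each coordinate circle, and `u = ∏ᵢ Pi.mulSingle i (u i)`).
[cite: BrockerTomDieck1985, II (8.1)] -/
theorem exists_eq_prod_zpow (c : (ι → Circle) →* ℂ) (hc : Continuous c) :
    ∃ m : ι → ℤ, ∀ u : ι → Circle, c u = ∏ i, (u i : ℂ) ^ m i := by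
  classical
  have hci : ∀ i : ι, ∃ n : ℤ, ∀ z : Circle, c (Pi.mulSingle i z) = (z : ℂ) ^ n := fun i => by
    have hms : Continuous fun z : Circle => (Pi.mulSingle i z : ι → Circle) :=
      continuous_mulSingle (A := fun _ : ι => Circle) i
    have hcont : Continuous fun z : Circle => c (Pi.mulSingle i z) := hc.comp hms
    obtain ⟨n, hn, -⟩ :=
      CircleChar.existsUnique_zpow_complex (c.comp (MonoidHom.mulSingle (fun _ : ι => Circle) i)) (by exact hcont)
    exact ⟨n, fun z => by simpa using hn z⟩
  choose m hm using hci
  refine ⟨m, fun u => ?_⟩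
  conv_lhs => rw [← Finset.univ_prod_mulSingle u, map_prod]
  exact Finset.prod_congr rfl fun i _ => hm i (u i)

/-- Uniqueness in `exists_eq_prod_zpow`. [cite: BrockerTomDieck1985, II (8.1)] -/
theorem existsUnique_eq_prod_zpow (c : (ι → Circle) →* ℂ) (hc : Continuous c) :
    ∃! m : ι → ℤ, ∀ u : ι → Circle, c u = ∏ i, (u i : ℂ) ^ m i := by
  obtain ⟨m, hm⟩ := exists_eq_prod_zpow c hc
  refine ⟨m, hm, fun m' hm' => prod_zpow_injective (funext fun u => ?_)⟩
  simp only
  rw [← hm' u, hm u]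

/-! ### Weight spaces -/

variable {W : Type*} [AddCommGroup W] [Module ℂ W]

/-- Unfolding of the joint weight space `⨅ u, eigenspace (ρ u) (∏ᵢ uᵢ^{mᵢ})`: `x` lies in it iff
`ρ u x = (∏ᵢ uᵢ^{mᵢ}) • x` for all `u`. [cite: BrockerTomDieck1985, II (8.2)] -/
theorem mem_weightSpace_iff (ρ : (ι → Circle) →* Module.End ℂ W) (m : ι → ℤ) (x : W) :
    x ∈ (⨅ u : ι → Circle, eigenspace (ρ u) (∏ i, (u i : ℂ) ^ m i)) ↔
      ∀ u : ι → Circle, ρ u x = (∏ i, (u i : ℂ) ^ m i) • x := by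
  simp only [Submodule.mem_iInf, mem_eigenspace_iff]

/-- **The weight spaces of a `U(1)^ι`-action are independent** (no topology, no finite-dimensionality).
[cite: BrockerTomDieck1985, II (8.2)] -/
theorem iSupIndep_weightSpace (ρ : (ι → Circle) →* Module.End ℂ W) :
    iSupIndep fun m : ι → ℤ => ⨅ u : ι → Circle, eigenspace (ρ u) (∏ i, (u i : ℂ) ^ m i) := by
  let f : (ι → Circle) → Module.End ℂ W := fun u => ρ u
  have hcomm : ∀ u v : ι → Circle, Commute (f u) (f v) := fun u v => by
    change ρ u * ρ v = ρ v * ρ u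
    rw [← map_mul, ← map_mul, mul_comm]
  have hind := Module.End.independent_iInf_maxGenEigenspace_of_forall_mapsTo f
    (fun i j φ => Module.End.mapsTo_maxGenEigenspace_of_comm (hcomm j i) φ)
  have hle : (fun m : ι → ℤ => ⨅ u : ι → Circle, eigenspace (ρ u) (∏ i, (u i : ℂ) ^ m i)) ≤
      (fun χ : (ι → Circle) → ℂ => ⨅ u, (f u).maxGenEigenspace (χ u)) ∘ fun m : ι → ℤ => fun u : ι → Circle =>
        ∏ i, (u i : ℂ) ^ m i := fun m =>
    iInf_mono fun u => eigenspace_le_maxGenEigenspace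
  exact (hind.comp prod_zpow_injective).mono hle

/-- `ρ u` preserves every weight space (the `ρ u` commute). [cite: BrockerTomDieck1985, II (8.2)] -/
theorem mapsTo_weightSpace (ρ : (ι → Circle) →* Module.End ℂ W) (u : ι → Circle) (m : ι → ℤ) :
    Set.MapsTo (ρ u) (⨅ v : ι → Circle, eigenspace (ρ v) (∏ i, (v i : ℂ) ^ m i) : Submodule ℂ W)
      (⨅ v : ι → Circle, eigenspace (ρ v) (∏ i, (v i : ℂ) ^ m i) : Submodule ℂ W) := by
  intro x hx
  rw [SetLike.mem_coe, mem_weightSpace_iff] at hx ⊢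
  intro v
  change (ρ v * ρ u) x = _
  rw [← map_mul, mul_comm, map_mul, Module.End.mul_apply, hx v, map_smul]

/-- On the weight space `W_m` the operator `ρ u` is the scalar `∏ᵢ uᵢ^{mᵢ}`. [cite: BrockerTomDieck1985, II (8.2)] -/
theorem restrict_weightSpace_eq_smul (ρ : (ι → Circle) →* Module.End ℂ W) (u : ι → Circle) (m : ι → ℤ) :
    (ρ u).restrict (mapsTo_weightSpace ρ u m) = (∏ i, (u i : ℂ) ^ m i) • LinearMap.id := by
  ext ⟨x, hx⟩
  simp only [LinearMap.coe_restrict_apply, LinearMap.smul_apply, LinearMap.id_coe, id_eq,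
    Submodule.coe_smul]
  exact (mem_weightSpace_iff ρ m x).mp hx u

/-- **A weight occurs iff it is carried by a non-zero weight vector**: `W_m ≠ 0` iff there is `x ≠ 0` with
`ρ u x = (∏ᵢ uᵢ^{mᵢ}) x` for all `u`. [cite: BrockerTomDieck1985, II (8.2)] -/
theorem weightSpace_ne_bot_iff (ρ : (ι → Circle) →* Module.End ℂ W) (m : ι → ℤ) :
    (⨅ u : ι → Circle, eigenspace (ρ u) (∏ i, (u i : ℂ) ^ m i)) ≠ ⊥ ↔
      ∃ x : W, x ≠ 0 ∧ ∀ u : ι → Circle, ρ u x = (∏ i, (u i : ℂ) ^ m i) • x := by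
  rw [Submodule.ne_bot_iff]
  exact ⟨fun ⟨x, hx, hx0⟩ => ⟨x, hx0, (mem_weightSpace_iff ρ m x).mp hx⟩,
    fun ⟨x, hx0, hx⟩ => ⟨x, (mem_weightSpace_iff ρ m x).mpr hx, hx0⟩⟩

variable [FiniteDimensional ℂ W]

/-- Only finitely many weight spaces of a finite-dimensional `U(1)^ι`-module are non-zero. [cite: BrockerTomDieck1985, II (8.2)] -/
theorem finite_weightSpace_ne_bot (ρ : (ι → Circle) →* Module.End ℂ W) :
    {m : ι → ℤ | (⨅ u : ι → Circle, eigenspace (ρ u) (∏ i, (u i : ℂ) ^ m i)) ≠ ⊥}.Finite := by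
  haveI := (iSupIndep_weightSpace ρ).fintypeNeBotOfFiniteDimensional
  have h : Finite {m : ι → ℤ // (⨅ u : ι → Circle, eigenspace (ρ u) (∏ i, (u i : ℂ) ^ m i)) ≠ ⊥} :=
    inferInstance
  exact Set.finite_coe_iff.mp h

variable [TopologicalSpace W] [IsTopologicalAddGroup W] [ContinuousSMul ℂ W] [T2Space W]

/-- **A finite-dimensional continuous representation of `U(1)^ι` is the sum of its weight spaces**: if
`ρ : U(1)^ι → End W` has continuous orbit maps on a finite-dimensional Hausdorff topological vector space `W`, then
`⨆_{m ∈ ℤ^ι} W_m = W`. [cite: BrockerTomDieck1985, II (8.2)] -/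
theorem iSup_weightSpace_eq_top (ρ : (ι → Circle) →* Module.End ℂ W) (hρ : ∀ x : W, Continuous fun u => ρ u x) :
    ⨆ m : ι → ℤ, (⨅ u : ι → Circle, eigenspace (ρ u) (∏ i, (u i : ℂ) ^ m i)) = ⊤ := by
  classical
  -- (A) the torsion acts by a commuting family of semisimple operators: joint eigenspaces span
  let T := {u : ι → Circle // IsOfFinOrder u}
  let f : T → Module.End ℂ W := fun t => ρ t.1
  have hcomm : Pairwise fun i j => Commute (f i) (f j) := fun i j _ => by
    change ρ i.1 * ρ j.1 = ρ j.1 * ρ i.1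
    rw [← map_mul, ← map_mul, mul_comm]
  have hss : ∀ t : T, (f t).IsFinitelySemisimple := fun t => by
    rw [Module.End.isFinitelySemisimple_iff_isSemisimple]
    obtain ⟨n, hn, hn1⟩ := isOfFinOrder_iff_pow_eq_one.mp t.2
    exact CircleWeights.isSemisimple_of_pow_eq_one hn (by rw [← map_pow, hn1, map_one])
  have htop : ⨆ χ : T → ℂ, ⨅ t, eigenspace (f t) (χ t) = ⊤ := by
    have h := Module.End.iSup_iInf_maxGenEigenspace_eq_top_of_iSup_maxGenEigenspace_eq_top_of_commute f
      hcomm fun t => Module.End.iSup_maxGenEigenspace_eq_top (f t)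
    have e : ∀ (t : T) (μ : ℂ), (f t).maxGenEigenspace μ = (f t).eigenspace μ := fun t μ =>
      (hss t).maxGenEigenspace_eq_eigenspace μ
    simp_rw [e] at h
    exact h
  -- (B) each joint eigenspace of the torsion lies in a weight space
  rw [eq_top_iff, ← htop]
  refine iSup_le fun χ => fun x hx => ?_
  by_cases hx0 : x = 0
  · rw [hx0]; exact Submodule.zero_mem _
  have hxT : ∀ t : T, ρ t.1 x = χ t • x := fun t =>
    mem_eigenspace_iff.mp ((Submodule.mem_iInf _).mp hx t)
  let L : Submodule ℂ W := ℂ ∙ x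
  have hLc : IsClosed (L : Set W) := L.closed_of_finiteDimensional
  have hS : ∀ u : ι → Circle, ρ u x ∈ L := by
    have hcl : IsClosed {u : ι → Circle | ρ u x ∈ L} := hLc.preimage (hρ x)
    have hsub : {u : ι → Circle | IsOfFinOrder u} ⊆ {u : ι → Circle | ρ u x ∈ L} := fun u hu => by
      simp only [Set.mem_setOf_eq, hxT ⟨u, hu⟩]
      exact L.smul_mem _ (Submodule.mem_span_singleton_self x)
    have huniv : {u : ι → Circle | ρ u x ∈ L} = Set.univ := by
      rw [← hcl.closure_eq]
      exact (dense_isOfFinOrder.mono hsub).closure_eq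
    exact fun u => Set.eq_univ_iff_forall.mp huniv u
  obtain ⟨ℓ, hℓ⟩ := LinearMap.exists_leftInverse_of_injective (LinearMap.toSpanSingleton ℂ W x)
    (LinearMap.ker_toSpanSingleton ℂ hx0)
  have hℓx : ∀ a : ℂ, ℓ (a • x) = a := fun a => by
    have h := LinearMap.congr_fun hℓ a
    simpa only [LinearMap.comp_apply, LinearMap.toSpanSingleton_apply, LinearMap.id_apply] using h
  have hc : ∀ u : ι → Circle, ρ u x = ℓ (ρ u x) • x := fun u => by
    obtain ⟨a, ha⟩ := Submodule.mem_span_singleton.mp (hS u)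
    rw [← ha, hℓx]
  let c : (ι → Circle) →* ℂ :=
    { toFun := fun u => ℓ (ρ u x)
      map_one' := by
        rw [map_one, Module.End.one_apply]
        simpa only [one_smul] using hℓx 1
      map_mul' := fun u v => by
        have hv := hc v
        have hu := hc u
        set a := ℓ (ρ v x)
        set b := ℓ (ρ u x)
        rw [map_mul, Module.End.mul_apply, hv, map_smul, hu, smul_smul, hℓx, mul_comm] }
  have hcc : Continuous c := ℓ.continuous_of_finiteDimensional.comp (hρ x)
  obtain ⟨m, hm⟩ := exists_eq_prod_zpow c hcc
  refine Submodule.mem_iSup_of_mem m ((mem_weightSpace_iff ρ m x).mpr fun u => ?_)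
  rw [hc u]
  exact congrArg (· • x) (hm u)

/-- **`W = ⊕_{m ∈ ℤ^ι} W_m`**: the weight-space decomposition of a finite-dimensional continuous `U(1)^ι`-module is an
internal direct sum. [cite: BrockerTomDieck1985, II (8.2)] -/
theorem isInternal_weightSpace (ρ : (ι → Circle) →* Module.End ℂ W) (hρ : ∀ x : W, Continuous fun u => ρ u x) :
    DirectSum.IsInternal fun m : ι → ℤ => ⨅ u : ι → Circle, eigenspace (ρ u) (∏ i, (u i : ℂ) ^ m i) :=
  DirectSum.isInternal_submodule_of_iSupIndep_of_iSup_eq_top (iSupIndep_weightSpace ρ)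
    (iSup_weightSpace_eq_top ρ hρ)

/-! ### The character on the torus -/

/-- **THE CHARACTER OF A TORUS MODULE ON THE TORUS**: `Tr ρ(u) = Σ_{m : W_m ≠ 0} dim(W_m) · ∏ᵢ uᵢ^{mᵢ}` — the
trace of `ρ u` is the weight multiplicity polynomial evaluated at `u`. [cite: BrockerTomDieck1985, II (8.2)] -/
theorem trace_eq_sum_finrank_mul_prod_zpow (ρ : (ι → Circle) →* Module.End ℂ W)
    (hρ : ∀ x : W, Continuous fun u => ρ u x) (u : ι → Circle) :
    LinearMap.trace ℂ W (ρ u) =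
      ∑ m ∈ (finite_weightSpace_ne_bot ρ).toFinset,
        (finrank ℂ (⨅ v : ι → Circle, eigenspace (ρ v) (∏ i, (v i : ℂ) ^ m i) : Submodule ℂ W) : ℂ) *
          ∏ i, (u i : ℂ) ^ m i := by
  rw [LinearMap.trace_eq_sum_trace_restrict' (isInternal_weightSpace ρ hρ) (finite_weightSpace_ne_bot ρ)
    (fun m => mapsTo_weightSpace ρ u m)]
  refine Finset.sum_congr rfl fun m _ => ?_
  rw [restrict_weightSpace_eq_smul, map_smul, LinearMap.trace_id, smul_eq_mul, mul_comm]

/-- **The weight multiplicities add up to the dimension**: `Σ_{m : W_m ≠ 0} dim W_m = dim W`.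
[cite: BrockerTomDieck1985, II (8.2)] -/
theorem sum_finrank_weightSpace_eq (ρ : (ι → Circle) →* Module.End ℂ W) (hρ : ∀ x : W, Continuous fun u => ρ u x) :
    ∑ m ∈ (finite_weightSpace_ne_bot ρ).toFinset,
        finrank ℂ (⨅ v : ι → Circle, eigenspace (ρ v) (∏ i, (v i : ℂ) ^ m i) : Submodule ℂ W) = finrank ℂ W := by
  have h := trace_eq_sum_finrank_mul_prod_zpow ρ hρ 1
  simp only [map_one, LinearMap.trace_one, Pi.one_apply, Circle.coe_one, one_zpow, Finset.prod_const_one,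
    mul_one] at h
  exact_mod_cast h.symm

end TorusWeights

end Literature.RepresentationTheory.CompactGroups

end
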